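import Literature.AlgebraicGeometry.HodgeTheory.KunnethStandardConjectureSurjections
import Literature.AlgebraicGeometry.HodgeTheory.KunnethStandardConjectureHypersurfaces
import Literature.AlgebraicGeometry.HodgeTheory.HodgeClassesBlowupBirationalInvarianceProofs
import HarnessLib

/-!
# Instances of the Künneth standard conjecture `C(X)` on the carriers: birational descent, products
# with smooth hypersurfaces and projective spaces, varieties dominated by them

Family `hodge`, layer `Literature/AlgebraicGeometry/HodgeTheory`; namespace
`Literature.AlgebraicGeometry.HodgeTheory`. Theorems only (no definition, no named fact, sorry-free);
corollaries assembling the tree's unconditional cases of `C` — smooth hypersurfaces and `ℙᴺ`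
(`kunnethComponent_diagonalClass_mem_algebraicClasses_of_isSmoothHypersurface`, `…_projectiveSpace`;
Kleiman: complete intersections satisfy `C`), `dim ≤ 2`, abelian varieties — with the stability of `C`
under products (`…_tensor_of_forall`, Kahn Lemma 6.30 (3)) and its descent along surjective
equidimensional morphisms (`…_of_surjective_of_forall`, Kahn Lemma 6.30 (2)):

* §1 **`kunnethComponent_diagonalClass_mem_algebraicClasses_of_isBirational`** — **`C(X) ⟹ C(W)` for a
  birational MORPHISM `g : X ⟶ W` of smooth projective `n`-folds** (e.g. `W` a smooth blow-down of `X`):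
  a proper birational morphism is surjective (`surjective_of_isBirational_of_universallyClosed'`,
  Hartshorne II Prop. 7.16 / Ex. II.4.4) and `C` descends along surjective equidimensional morphisms;
  family-free form `…_of_isBirational_of_forall`.
* §2 Products: **`…_isSmoothHypersurface_tensor`** (`C(V ⊗ Y)` for a smooth hypersurface `V ⊂ ℙᵐ⁺¹`
  and `C(Y)`), `…_isSmoothHypersurface_tensor_isSmoothHypersurface` (`C(V ⊗ V')`),
  `…_isSmoothHypersurface_tensor_of_le_two` (`C(V ⊗ S)`, `dim S ≤ 2`),
  `…_abelianVariety_tensor_isSmoothHypersurface` (`C(A ⊗ V)`), **`…_projectiveSpace_tensor`**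
  (`C(ℙᴺ ⊗ Y)` from `C(Y)`), `…_projectiveSpace_tensor_isSmoothHypersurface` (`C(ℙᴺ ⊗ V)`).
* §3 Domination: `…_of_surjective_isSmoothHypersurface` (`C(W)` for `W` dominated equidimensionally
  by a smooth hypersurface), `…_of_surjective_isSmoothHypersurface_tensor` (by a product of two smooth
  hypersurfaces), `…_of_surjective_projectiveSpace_tensor` (by `ℙᴺ ⊗ Y` with `C(Y)`).

## References

* [Kahn2020] B. Kahn, Zeta and L-functions of varieties and motives, LMS LN 462, CUP 2020, §6.9
  Lemma 6.30 (2)–(3), Theorem 6.31.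
* [Kleiman1968AlgebraicCycles] S. Kleiman, Algebraic cycles and the Weil conjectures (1968), §2.
* [Hartshorne1977] R. Hartshorne, Algebraic Geometry, Springer 1977, II Prop. 7.16 and Ex. II.4.4.
* [Fulton1998] W. Fulton, Intersection Theory, 2nd ed., Springer 1998, §16.1 Ex. 16.1.11.
* [Voisin2025] C. Voisin, Hodge and generalized Hodge conjectures, coniveau and algebraic cycles,
  J. Open Math. Probl. 1 (2025), §3.2.1 Cor. 3.9, §3.2.2.
-/

noncomputable section

open CategoryTheory AlgebraicGeometry MonoidalCategory CartesianMonoidalCategory Finset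
open Literature.AlgebraicTopology.SingularHomology
open Literature.AlgebraicGeometry.Motives

namespace Literature.AlgebraicGeometry.HodgeTheory

variable {m n N d d' : ℕ} {X Y V V' W : SchemeOver ℂ}

/-! ### §1 Birational descent -/

/-- **`C(X) ⟹ C(W)` for a birational morphism `g : X ⟶ W` of smooth projective varieties of dimension
`n`**: `g` is proper (`isProper_left_of_isSmoothProjective`), hence surjective
(`surjective_of_isBirational_of_universallyClosed'`: its closed image contains a dense open), and `C`
descends along surjective equidimensional morphisms
(`kunnethComponent_diagonalClass_mem_algebraicClasses_of_surjective`).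
[cite: Kahn2020, §6.9 Lemma 6.30 (2)] [cite: Hartshorne1977, II Prop. 7.16 and Ex. II.4.4]
[cite: Fulton1998, §16.1 Ex. 16.1.11] -/
theorem kunnethComponent_diagonalClass_mem_algebraicClasses_of_isBirational (hX : IsSmoothProjective n X)
    (hW : IsSmoothProjective n W) (g : X ⟶ W) (hg : Resolution.IsBirational g.left)
    {π : Fin (2 * n + 1) → complexBetti (X ⊗ X) (2 * n)}
    (hπ : ∀ i : Fin (2 * n + 1), π i ∈ kunnethPiece X X (show (2 * n - (i : ℕ)) + i = 2 * n by omega))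
    (hΔ : ∑ i, π i = diagonalClass hX) (hC : ∀ i, π i ∈ algebraicClasses (X ⊗ X) n)
    {πW : Fin (2 * n + 1) → complexBetti (W ⊗ W) (2 * n)}
    (hπW : ∀ i : Fin (2 * n + 1), πW i ∈ kunnethPiece W W (show (2 * n - (i : ℕ)) + i = 2 * n by omega))
    (hΔW : ∑ i, πW i = diagonalClass hW) (i : Fin (2 * n + 1)) :
    πW i ∈ algebraicClasses (W ⊗ W) n := by
  haveI : IsProper g.left := isProper_left_of_isSmoothProjective hX hW g
  haveI : Surjective g.left := surjective_of_isBirational_of_universallyClosed' g.left hg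
  exact kunnethComponent_diagonalClass_mem_algebraicClasses_of_surjective hX hW g hπ hΔ hC hπW hΔW i

/-- **`C(X) ⟹ C(W)` for a birational morphism `X ⟶ W` of smooth projective `n`-folds**, family-free
form. [cite: Kahn2020, §6.9 Lemma 6.30 (2)] [cite: Hartshorne1977, II Prop. 7.16 and Ex. II.4.4] -/
theorem kunnethComponent_diagonalClass_mem_algebraicClasses_of_isBirational_of_forall
    (hX : IsSmoothProjective n X) (hW : IsSmoothProjective n W) (g : X ⟶ W)
    (hg : Resolution.IsBirational g.left)
    (hCX : ∀ (πX : Fin (2 * n + 1) → complexBetti (X ⊗ X) (2 * n)),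
      (∀ i : Fin (2 * n + 1), πX i ∈ kunnethPiece X X (show (2 * n - (i : ℕ)) + i = 2 * n by omega)) →
      ∑ i, πX i = diagonalClass hX → ∀ i, πX i ∈ algebraicClasses (X ⊗ X) n)
    {πW : Fin (2 * n + 1) → complexBetti (W ⊗ W) (2 * n)}
    (hπW : ∀ i : Fin (2 * n + 1), πW i ∈ kunnethPiece W W (show (2 * n - (i : ℕ)) + i = 2 * n by omega))
    (hΔW : ∑ i, πW i = diagonalClass hW) (i : Fin (2 * n + 1)) :
    πW i ∈ algebraicClasses (W ⊗ W) n := by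
  haveI : IsProper g.left := isProper_left_of_isSmoothProjective hX hW g
  haveI : Surjective g.left := surjective_of_isBirational_of_universallyClosed' g.left hg
  exact kunnethComponent_diagonalClass_mem_algebraicClasses_of_surjective_of_forall hX hW g hCX hπW hΔW i

/-! ### §2 Products with smooth hypersurfaces and projective spaces -/

/-- **`C(V ⊗ Y)` for a smooth hypersurface `V ⊂ ℙᵐ⁺¹_ℂ` and a smooth projective `Y` with `C(Y)`**:
`C(V)` (`kunnethComponent_diagonalClass_mem_algebraicClasses_of_isSmoothHypersurface`) and stability
under products. [cite: Kahn2020, §6.9 Lemma 6.30 (3)] [cite: Kleiman1968AlgebraicCycles, §2]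
[cite: Voisin2025, §3.2.1 Cor. 3.9] -/
theorem kunnethComponent_diagonalClass_mem_algebraicClasses_isSmoothHypersurface_tensor
    (hV : IsSmoothHypersurface m d V) (hY : IsSmoothProjective n Y)
    (hCY : ∀ (πY : Fin (2 * n + 1) → complexBetti (Y ⊗ Y) (2 * n)),
      (∀ j : Fin (2 * n + 1), πY j ∈ kunnethPiece Y Y (show (2 * n - (j : ℕ)) + j = 2 * n by omega)) →
      ∑ j, πY j = diagonalClass hY → ∀ j, πY j ∈ algebraicClasses (Y ⊗ Y) n)
    {π : Fin (2 * (m + n) + 1) → complexBetti ((V ⊗ Y) ⊗ (V ⊗ Y)) (2 * (m + n))}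
    (hπ : ∀ k : Fin (2 * (m + n) + 1), π k ∈ kunnethPiece (V ⊗ Y) (V ⊗ Y)
      (show (2 * (m + n) - (k : ℕ)) + k = 2 * (m + n) by omega))
    (hΔ : ∑ k, π k = diagonalClass (IsSmoothProjective.tensor_holds hV.1 hY))
    (k : Fin (2 * (m + n) + 1)) :
    π k ∈ algebraicClasses ((V ⊗ Y) ⊗ (V ⊗ Y)) (m + n) :=
  kunnethComponent_diagonalClass_mem_algebraicClasses_tensor_of_forall hV.1 hY
    (fun _ hπV hΔV i ↦
      kunnethComponent_diagonalClass_mem_algebraicClasses_of_isSmoothHypersurface hV hπV hΔV i)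
    hCY hπ hΔ k

/-- **`C(V ⊗ V')` for two smooth hypersurfaces `V ⊂ ℙᵐ⁺¹_ℂ`, `V' ⊂ ℙⁿ⁺¹_ℂ`.**
[cite: Kahn2020, §6.9 Lemma 6.30 (3)] [cite: Kleiman1968AlgebraicCycles, §2] -/
theorem kunnethComponent_diagonalClass_mem_algebraicClasses_isSmoothHypersurface_tensor_isSmoothHypersurface
    (hV : IsSmoothHypersurface m d V) (hV' : IsSmoothHypersurface n d' V')
    {π : Fin (2 * (m + n) + 1) → complexBetti ((V ⊗ V') ⊗ (V ⊗ V')) (2 * (m + n))}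
    (hπ : ∀ k : Fin (2 * (m + n) + 1), π k ∈ kunnethPiece (V ⊗ V') (V ⊗ V')
      (show (2 * (m + n) - (k : ℕ)) + k = 2 * (m + n) by omega))
    (hΔ : ∑ k, π k = diagonalClass (IsSmoothProjective.tensor_holds hV.1 hV'.1))
    (k : Fin (2 * (m + n) + 1)) :
    π k ∈ algebraicClasses ((V ⊗ V') ⊗ (V ⊗ V')) (m + n) :=
  kunnethComponent_diagonalClass_mem_algebraicClasses_isSmoothHypersurface_tensor hV hV'.1
    (fun _ hπV hΔV j ↦
      kunnethComponent_diagonalClass_mem_algebraicClasses_of_isSmoothHypersurface hV' hπV hΔV j) hπ hΔ k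

/-- **`C(V ⊗ S)` for a smooth hypersurface `V` and `dim S ≤ 2`** (e.g. `V × C`, `V × S` for a curve `C`,
a surface `S`). [cite: Kahn2020, §6.9 Lemma 6.30 (3) and Theorem 6.31 (1)–(2)]
[cite: Voisin2025, §3.2.1 Cor. 3.9] -/
theorem kunnethComponent_diagonalClass_mem_algebraicClasses_isSmoothHypersurface_tensor_of_le_two
    (hV : IsSmoothHypersurface m d V) (hY : IsSmoothProjective n Y) (hn : n ≤ 2)
    {π : Fin (2 * (m + n) + 1) → complexBetti ((V ⊗ Y) ⊗ (V ⊗ Y)) (2 * (m + n))}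
    (hπ : ∀ k : Fin (2 * (m + n) + 1), π k ∈ kunnethPiece (V ⊗ Y) (V ⊗ Y)
      (show (2 * (m + n) - (k : ℕ)) + k = 2 * (m + n) by omega))
    (hΔ : ∑ k, π k = diagonalClass (IsSmoothProjective.tensor_holds hV.1 hY))
    (k : Fin (2 * (m + n) + 1)) :
    π k ∈ algebraicClasses ((V ⊗ Y) ⊗ (V ⊗ Y)) (m + n) :=
  kunnethComponent_diagonalClass_mem_algebraicClasses_isSmoothHypersurface_tensor hV hY
    (fun _ hπY hΔY j ↦ kunnethComponent_diagonalClass_mem_algebraicClasses_of_le_two hY hn hπY hΔY j)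
    hπ hΔ k

/-- **`C(A ⊗ V)` for a complex abelian variety `A` and a smooth hypersurface `V`.**
[cite: Kahn2020, §6.9 Lemma 6.30 (3) and Theorem 6.31 (3)] [cite: Kleiman1968AlgebraicCycles, §2] -/
theorem kunnethComponent_diagonalClass_mem_algebraicClasses_abelianVariety_tensor_isSmoothHypersurface
    (A : AbelianVariety ℂ) (hV : IsSmoothHypersurface n d V)
    {π : Fin (2 * (A.dim + n) + 1) → complexBetti ((A.X ⊗ V) ⊗ (A.X ⊗ V)) (2 * (A.dim + n))}
    (hπ : ∀ k : Fin (2 * (A.dim + n) + 1), π k ∈ kunnethPiece (A.X ⊗ V) (A.X ⊗ V)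
      (show (2 * (A.dim + n) - (k : ℕ)) + k = 2 * (A.dim + n) by omega))
    (hΔ : ∑ k, π k = diagonalClass (IsSmoothProjective.tensor_holds
      (AbelianVariety.isSmoothProjective_holds (A := A)) hV.1))
    (k : Fin (2 * (A.dim + n) + 1)) :
    π k ∈ algebraicClasses ((A.X ⊗ V) ⊗ (A.X ⊗ V)) (A.dim + n) :=
  kunnethComponent_diagonalClass_mem_algebraicClasses_abelianVariety_tensor A hV.1
    (fun _ hπV hΔV j ↦
      kunnethComponent_diagonalClass_mem_algebraicClasses_of_isSmoothHypersurface hV hπV hΔV j) hπ hΔ k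

/-- **`C(ℙᴺ ⊗ Y)` for a smooth projective `Y` with `C(Y)`**: `C(ℙᴺ)`
(`kunnethComponent_diagonalClass_mem_algebraicClasses_projectiveSpace`) and stability under products.
[cite: Kahn2020, §6.9 Lemma 6.30 (3)] [cite: Kleiman1968AlgebraicCycles, §2] -/
theorem kunnethComponent_diagonalClass_mem_algebraicClasses_projectiveSpace_tensor (N : ℕ)
    (hY : IsSmoothProjective n Y)
    (hCY : ∀ (πY : Fin (2 * n + 1) → complexBetti (Y ⊗ Y) (2 * n)),
      (∀ j : Fin (2 * n + 1), πY j ∈ kunnethPiece Y Y (show (2 * n - (j : ℕ)) + j = 2 * n by omega)) →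
      ∑ j, πY j = diagonalClass hY → ∀ j, πY j ∈ algebraicClasses (Y ⊗ Y) n)
    {π : Fin (2 * (N + n) + 1) →
      complexBetti ((projectiveSpace N ℂ ⊗ Y) ⊗ (projectiveSpace N ℂ ⊗ Y)) (2 * (N + n))}
    (hπ : ∀ k : Fin (2 * (N + n) + 1), π k ∈ kunnethPiece (projectiveSpace N ℂ ⊗ Y) (projectiveSpace N ℂ ⊗ Y)
      (show (2 * (N + n) - (k : ℕ)) + k = 2 * (N + n) by omega))
    (hΔ : ∑ k, π k = diagonalClass (IsSmoothProjective.tensor_holds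
      (isSmoothProjective_projectiveSpace_holds ℂ N : IsSmoothProjective N (projectiveSpace N ℂ)) hY))
    (k : Fin (2 * (N + n) + 1)) :
    π k ∈ algebraicClasses ((projectiveSpace N ℂ ⊗ Y) ⊗ (projectiveSpace N ℂ ⊗ Y)) (N + n) :=
  kunnethComponent_diagonalClass_mem_algebraicClasses_tensor_of_forall
    (isSmoothProjective_projectiveSpace_holds ℂ N : IsSmoothProjective N (projectiveSpace N ℂ)) hY
    (fun _ hπP hΔP i ↦ kunnethComponent_diagonalClass_mem_algebraicClasses_projectiveSpace N hπP hΔP i)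
    hCY hπ hΔ k

/-- **`C(ℙᴺ ⊗ V)` for a smooth hypersurface `V`.** [cite: Kahn2020, §6.9 Lemma 6.30 (3)]
[cite: Kleiman1968AlgebraicCycles, §2] -/
theorem kunnethComponent_diagonalClass_mem_algebraicClasses_projectiveSpace_tensor_isSmoothHypersurface
    (N : ℕ) (hV : IsSmoothHypersurface n d V)
    {π : Fin (2 * (N + n) + 1) →
      complexBetti ((projectiveSpace N ℂ ⊗ V) ⊗ (projectiveSpace N ℂ ⊗ V)) (2 * (N + n))}
    (hπ : ∀ k : Fin (2 * (N + n) + 1), π k ∈ kunnethPiece (projectiveSpace N ℂ ⊗ V) (projectiveSpace N ℂ ⊗ V)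
      (show (2 * (N + n) - (k : ℕ)) + k = 2 * (N + n) by omega))
    (hΔ : ∑ k, π k = diagonalClass (IsSmoothProjective.tensor_holds
      (isSmoothProjective_projectiveSpace_holds ℂ N : IsSmoothProjective N (projectiveSpace N ℂ)) hV.1))
    (k : Fin (2 * (N + n) + 1)) :
    π k ∈ algebraicClasses ((projectiveSpace N ℂ ⊗ V) ⊗ (projectiveSpace N ℂ ⊗ V)) (N + n) :=
  kunnethComponent_diagonalClass_mem_algebraicClasses_projectiveSpace_tensor N hV.1
    (fun _ hπV hΔV j ↦
      kunnethComponent_diagonalClass_mem_algebraicClasses_of_isSmoothHypersurface hV hπV hΔV j) hπ hΔ k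

/-! ### §3 Varieties dominated by hypersurfaces and by their products -/

/-- **`C(W)` for `W` dominated equidimensionally by a smooth hypersurface** (`g : V ⟶ W` surjective,
`dim W = dim V`; e.g. smooth quotients of smooth hypersurfaces).
[cite: Kahn2020, §6.9 Lemma 6.30 (2)] [cite: Kleiman1968AlgebraicCycles, §2] -/
theorem kunnethComponent_diagonalClass_mem_algebraicClasses_of_surjective_isSmoothHypersurface
    (hV : IsSmoothHypersurface n d V) (hW : IsSmoothProjective n W) (g : V ⟶ W) [Surjective g.left]
    {πW : Fin (2 * n + 1) → complexBetti (W ⊗ W) (2 * n)}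
    (hπW : ∀ i : Fin (2 * n + 1), πW i ∈ kunnethPiece W W (show (2 * n - (i : ℕ)) + i = 2 * n by omega))
    (hΔW : ∑ i, πW i = diagonalClass hW) (i : Fin (2 * n + 1)) :
    πW i ∈ algebraicClasses (W ⊗ W) n :=
  kunnethComponent_diagonalClass_mem_algebraicClasses_of_surjective_of_forall hV.1 hW g
    (fun _ hπV hΔV j ↦
      kunnethComponent_diagonalClass_mem_algebraicClasses_of_isSmoothHypersurface hV hπV hΔV j) hπW hΔW i

/-- **`C(W)` for `W` dominated equidimensionally by a product of two smooth hypersurfaces**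
(`g : V ⊗ V' ⟶ W` surjective, `dim W = dim V + dim V'`).
[cite: Kahn2020, §6.9 Lemma 6.30 (2)–(3)] [cite: Kleiman1968AlgebraicCycles, §2] -/
theorem kunnethComponent_diagonalClass_mem_algebraicClasses_of_surjective_isSmoothHypersurface_tensor
    (hV : IsSmoothHypersurface m d V) (hV' : IsSmoothHypersurface n d' V')
    (hW : IsSmoothProjective (m + n) W) (g : V ⊗ V' ⟶ W) [Surjective g.left]
    {πW : Fin (2 * (m + n) + 1) → complexBetti (W ⊗ W) (2 * (m + n))}
    (hπW : ∀ k : Fin (2 * (m + n) + 1), πW k ∈ kunnethPiece W W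
      (show (2 * (m + n) - (k : ℕ)) + k = 2 * (m + n) by omega))
    (hΔW : ∑ k, πW k = diagonalClass hW) (k : Fin (2 * (m + n) + 1)) :
    πW k ∈ algebraicClasses (W ⊗ W) (m + n) :=
  kunnethComponent_diagonalClass_mem_algebraicClasses_of_surjective_tensor hV.1 hV'.1 hW g
    (fun _ hπV hΔV i ↦
      kunnethComponent_diagonalClass_mem_algebraicClasses_of_isSmoothHypersurface hV hπV hΔV i)
    (fun _ hπV hΔV j ↦
      kunnethComponent_diagonalClass_mem_algebraicClasses_of_isSmoothHypersurface hV' hπV hΔV j)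
    hπW hΔW k

/-- **`C(W)` for `W` dominated equidimensionally by `ℙᴺ ⊗ Y` with `C(Y)`** (`g : ℙᴺ ⊗ Y ⟶ W`
surjective, `dim W = N + dim Y`). [cite: Kahn2020, §6.9 Lemma 6.30 (2)–(3)]
[cite: Kleiman1968AlgebraicCycles, §2] -/
theorem kunnethComponent_diagonalClass_mem_algebraicClasses_of_surjective_projectiveSpace_tensor (N : ℕ)
    (hY : IsSmoothProjective n Y)
    (hCY : ∀ (πY : Fin (2 * n + 1) → complexBetti (Y ⊗ Y) (2 * n)),
      (∀ j : Fin (2 * n + 1), πY j ∈ kunnethPiece Y Y (show (2 * n - (j : ℕ)) + j = 2 * n by omega)) →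
      ∑ j, πY j = diagonalClass hY → ∀ j, πY j ∈ algebraicClasses (Y ⊗ Y) n)
    (hW : IsSmoothProjective (N + n) W) (g : projectiveSpace N ℂ ⊗ Y ⟶ W) [Surjective g.left]
    {πW : Fin (2 * (N + n) + 1) → complexBetti (W ⊗ W) (2 * (N + n))}
    (hπW : ∀ k : Fin (2 * (N + n) + 1), πW k ∈ kunnethPiece W W
      (show (2 * (N + n) - (k : ℕ)) + k = 2 * (N + n) by omega))
    (hΔW : ∑ k, πW k = diagonalClass hW) (k : Fin (2 * (N + n) + 1)) :
    πW k ∈ algebraicClasses (W ⊗ W) (N + n) :=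
  kunnethComponent_diagonalClass_mem_algebraicClasses_of_surjective_tensor
    (isSmoothProjective_projectiveSpace_holds ℂ N : IsSmoothProjective N (projectiveSpace N ℂ)) hY hW g
    (fun _ hπP hΔP i ↦ kunnethComponent_diagonalClass_mem_algebraicClasses_projectiveSpace N hπP hΔP i)
    hCY hπW hΔW k

end Literature.AlgebraicGeometry.HodgeTheory

end
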